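import Mathlib.Topology.Covering.Quotient
import Mathlib.Topology.Algebra.Group.DiscontinuousSubgroup
import Mathlib.Topology.Compactness.LocallyCompact
import Mathlib.GroupTheory.QuotientGroup.Defs
import Mathlib.Tactic.Group
import HarnessLib

/-!
# Intermediate quotients of quotient covering maps

Topic `Literature/Topology/CoveringSpaces` (general topology infrastructure; written for the
intermediate modular curves `Y_Γ = ℍ/Γ → Y(2)` of F. Calegari, V. Dimitrov, Y. Tang, *The unbounded
denominators conjecture*, J. Amer. Math. Soc. **38** (2025), arXiv:2109.09040, §1 p. 3 and §3
Remark 16, which are quotients of the universal covering `ℍ → Y(2)` by subgroups of its deck group).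

Let a group `G` act on `X` and let `N ⊴ G` be a normal subgroup. We set up the action of `G ⧸ N`
on the orbit space `X ⧸ N = MulAction.orbitRel.Quotient N X` (`OrbitQuotient.mulAction`,
`(gN) • [x] = [g • x]`, `OrbitQuotient.mk_smul_mk`) and PROVE:

* `OrbitQuotient.mk_mem_orbit_mk_iff` — the `G ⧸ N`-orbits downstairs are the `G`-orbits;
* `OrbitQuotient.isCancelSMul` — the action is free if `G` acts freely;
* `OrbitQuotient.continuousConstSMul`, `OrbitQuotient.locallyCompactSpace`,
  `OrbitQuotient.properlyDiscontinuousSMul` — it is by homeomorphisms, `X ⧸ N` is locally compact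
  if `X` is, and the action is properly discontinuous if that of `G` on the (weakly locally
  compact) `X` is (compact sets of `X ⧸ N` are covered by images of compact sets of `X`);
* **`OrbitQuotient.isQuotientCoveringMap_lift`, `OrbitQuotient.isCoveringMap_lift`** — if
  `f : X → V` is the quotient map of a free, properly discontinuous action of `G` on a locally
  compact Hausdorff `X` (so a quotient covering map, Mathlib
  `IsQuotientMap.isQuotientCoveringMap_of_properlyDiscontinuousSMul`), then the induced
  `f̄ : X ⧸ N → V` is the quotient covering map of `G ⧸ N` acting on `X ⧸ N`; in particular a
  covering map.

## References

* [CalegariDimitrovTang2025] arXiv:2109.09040, §1 p. 3 (`Y_Γ = ℍ/Γ → ℍ/Γ(2) = Y(2)`), §3 Remark 16.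
* Folklore (e.g. A. Hatcher, *Algebraic Topology*, §1.3, Prop. 1.40 and Ex. 24: normal coverings
  and intermediate coverings `X̃/H → X`).
-/

open Set Filter Topology MulAction

namespace Literature.Topology.CoveringSpaces

namespace OrbitQuotient

variable {G X : Type*} [Group G] [MulAction G X] (N : Subgroup G) [hN : N.Normal]

/-- Compatibility of the `G`-action with `N`-cosets and `N`-orbits (`N` normal): if
`a₁⁻¹ a₂ ∈ N` and `x₁ ∈ N • x₂` then `a₁ • x₁ ∈ N • (a₂ • x₂)`. [folklore] -/
theorem smul_mem_orbit_smul {a₁ a₂ : G} (h : a₁⁻¹ * a₂ ∈ N) {x₁ x₂ : X}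
    (hx : x₁ ∈ orbit N x₂) : a₁ • x₁ ∈ orbit N (a₂ • x₂) := by
  obtain ⟨n, rfl⟩ := hx
  refine ⟨⟨a₁ * ((n : G) * (a₁⁻¹ * a₂)⁻¹) * a₁⁻¹,
    hN.conj_mem _ (mul_mem n.2 (inv_mem h)) a₁⟩, ?_⟩
  change (a₁ * ((n : G) * (a₁⁻¹ * a₂)⁻¹) * a₁⁻¹) • a₂ • x₂ = a₁ • ((n : G) • x₂)
  rw [← mul_smul, ← mul_smul]
  congr 1
  group

/-- The action of `G ⧸ N` on `X ⧸ N`: `(gN) • [x] = [g • x]`. [folklore] -/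
instance smul : SMul (G ⧸ N) (orbitRel.Quotient N X) :=
  ⟨Quotient.map₂ (· • ·) fun _ _ ha _ _ hx ↦
    smul_mem_orbit_smul N (QuotientGroup.leftRel_apply.mp ha) hx⟩

/-- `(gN) • [x] = [g • x]`. [folklore] -/
theorem mk_smul_mk (g : G) (x : X) :
    (QuotientGroup.mk g : G ⧸ N) • (Quotient.mk (orbitRel N X) x : orbitRel.Quotient N X) =
      Quotient.mk (orbitRel N X) (g • x) :=
  rfl

/-- **The action of `G ⧸ N` on the orbit space `X ⧸ N`** (`N` a normal subgroup of `G`).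
[folklore] -/
instance mulAction : MulAction (G ⧸ N) (orbitRel.Quotient N X) where
  one_smul y := by
    induction y using Quotient.inductionOn with
    | h x =>
      change (QuotientGroup.mk (1 : G) : G ⧸ N) • (Quotient.mk (orbitRel N X) x) = _
      rw [mk_smul_mk, one_smul]
  mul_smul q q' y := by
    induction q using QuotientGroup.induction_on with
    | H a =>
    induction q' using QuotientGroup.induction_on with
    | H b =>
    induction y using Quotient.inductionOn with
    | h x =>
      rw [← QuotientGroup.mk_mul, mk_smul_mk, mk_smul_mk, mk_smul_mk, mul_smul]

/-- The orbits of `G ⧸ N` on `X ⧸ N` are the images of the orbits of `G`. [folklore] -/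
theorem mk_mem_orbit_mk_iff {x y : X} :
    (Quotient.mk (orbitRel N X) x : orbitRel.Quotient N X) ∈
        orbit (G ⧸ N) (Quotient.mk (orbitRel N X) y) ↔ x ∈ orbit G y := by
  constructor
  · intro h
    obtain ⟨q, hq⟩ := MulAction.mem_orbit_iff.mp h
    induction q using QuotientGroup.induction_on with
    | H g =>
      rw [mk_smul_mk] at hq
      obtain ⟨n, hn⟩ := MulAction.mem_orbit_iff.mp (Quotient.exact hq)
      exact MulAction.mem_orbit_iff.mpr ⟨(n : G)⁻¹ * g, by
        rw [mul_smul, ← hn, Subgroup.smul_def, inv_smul_smul]⟩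
  · rintro ⟨g, rfl⟩
    exact ⟨QuotientGroup.mk g, rfl⟩

/-- `G ⧸ N` acts freely on `X ⧸ N` when `G` acts freely on `X`. [folklore] -/
theorem isCancelSMul [IsCancelSMul G X] : IsCancelSMul (G ⧸ N) (orbitRel.Quotient N X) := by
  refine isCancelSMul_iff_eq_one_of_smul_eq.mpr fun q y h ↦ ?_
  induction q using QuotientGroup.induction_on with
  | H g =>
  induction y using Quotient.inductionOn with
  | h x =>
    rw [mk_smul_mk] at h
    obtain ⟨n, hn⟩ := MulAction.mem_orbit_iff.mp (Quotient.exact h)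
    -- `n • x = g • x`, so `g = n ∈ N`
    have : g = (n : G) := (IsCancelSMul.right_cancel _ _ _ hn).symm
    rw [this]
    exact (QuotientGroup.eq_one_iff _).mpr n.2

variable [TopologicalSpace X]

/-- A subgroup acts by homeomorphisms if the group does. [folklore] -/
instance subgroupContinuousConstSMul [ContinuousConstSMul G X] (S : Subgroup G) :
    ContinuousConstSMul S X :=
  ⟨fun s ↦ continuous_const_smul (s : G)⟩

/-- The action of `G ⧸ N` on `X ⧸ N` is by homeomorphisms. [folklore] -/
instance continuousConstSMul [ContinuousConstSMul G X] :
    ContinuousConstSMul (G ⧸ N) (orbitRel.Quotient N X) := by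
  refine ⟨fun q ↦ ?_⟩
  induction q using QuotientGroup.induction_on with
  | H g =>
    have hq : IsQuotientMap (Quotient.mk (orbitRel N X)) := isQuotientMap_quotient_mk'
    refine hq.continuous_iff.mpr ?_
    have : (fun y : orbitRel.Quotient N X ↦ (QuotientGroup.mk g : G ⧸ N) • y) ∘
        Quotient.mk (orbitRel N X) = Quotient.mk (orbitRel N X) ∘ fun x ↦ g • x := by
      funext x
      exact mk_smul_mk N g x
    rw [this]
    exact continuous_quotient_mk'.comp (continuous_const_smul g)

omit hN in
/-- `X ⧸ N` is locally compact if `X` is. [folklore] -/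
theorem locallyCompactSpace [LocallyCompactSpace X] [ContinuousConstSMul G X] :
    LocallyCompactSpace (orbitRel.Quotient N X) :=
  (MulAction.isOpenQuotientMap_quotientMk (Γ := N) (T := X)).locallyCompactSpace

/-- **Proper discontinuity descends**: if `G` acts properly discontinuously on a weakly locally
compact `X`, then `G ⧸ N` acts properly discontinuously on `X ⧸ N`. [folklore] -/
theorem properlyDiscontinuousSMul [WeaklyLocallyCompactSpace X] [ContinuousConstSMul G X]
    [ProperlyDiscontinuousSMul G X] :
    ProperlyDiscontinuousSMul (G ⧸ N) (orbitRel.Quotient N X) := by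
  have hπ : IsOpenQuotientMap (Quotient.mk (orbitRel N X)) :=
    MulAction.isOpenQuotientMap_quotientMk
  -- compact sets downstairs are covered by images of compact sets upstairs
  have hlift : ∀ K : Set (orbitRel.Quotient N X), IsCompact K →
      ∃ K' : Set X, IsCompact K' ∧ K ⊆ Quotient.mk (orbitRel N X) '' K' := by
    intro K hK
    have hcover : K ⊆ ⋃ x : X, Quotient.mk (orbitRel N X) '' interior (Classical.choose
        (exists_compact_mem_nhds x)) := by
      intro k _
      obtain ⟨x, rfl⟩ := Quotient.mk_surjective k
      have hx := (Classical.choose_spec (exists_compact_mem_nhds x)).2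
      exact mem_iUnion.mpr ⟨x, mem_image_of_mem _ (mem_interior_iff_mem_nhds.mpr hx)⟩
    obtain ⟨t, ht⟩ := hK.elim_finite_subcover _
      (fun x ↦ hπ.isOpenMap _ isOpen_interior) hcover
    refine ⟨⋃ x ∈ t, Classical.choose (exists_compact_mem_nhds x),
      t.isCompact_biUnion fun x _ ↦ (Classical.choose_spec (exists_compact_mem_nhds x)).1, ?_⟩
    intro k hk
    obtain ⟨x, hx, hk'⟩ := mem_iUnion₂.mp (ht hk)
    obtain ⟨y, hy, rfl⟩ := hk'
    exact ⟨y, mem_iUnion₂.mpr ⟨x, hx, interior_subset hy⟩, rfl⟩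
  refine ⟨fun {K L} hK hL ↦ ?_⟩
  obtain ⟨K', hK', hKK'⟩ := hlift K hK
  obtain ⟨L', hL', hLL'⟩ := hlift L hL
  have hfin := ProperlyDiscontinuousSMul.finite_disjoint_inter_image (Γ := G) hK' hL'
  refine (hfin.image (QuotientGroup.mk : G → G ⧸ N)).subset ?_
  intro q hq
  induction q using QuotientGroup.induction_on with
  | H g =>
    obtain ⟨_, ⟨k, hk, rfl⟩, hl⟩ := hq
    obtain ⟨x, hx, rfl⟩ := hKK' hk
    obtain ⟨y, hy, hyx⟩ := hLL' hl
    dsimp only at hyx hl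
    rw [mk_smul_mk] at hyx
    obtain ⟨n, hn⟩ := MulAction.mem_orbit_iff.mp (Quotient.exact hyx.symm)
    -- `hn : n • y = g • x`, so `(n⁻¹ g) • x = y ∈ L'` with `x ∈ K'`, and `[n⁻¹ g] = [g]`
    have hγ : ((n : G)⁻¹ * g) • x = y := by
      rw [mul_smul, ← hn, Subgroup.smul_def, inv_smul_smul]
    refine ⟨(n : G)⁻¹ * g, ⟨y, ⟨x, hx, hγ⟩, hy⟩, ?_⟩
    apply QuotientGroup.eq.mpr
    rw [mul_inv_rev, inv_inv]
    exact hN.conj_mem' _ n.2 g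

variable {V : Type*} [TopologicalSpace V]

/-- **Intermediate quotients of quotient covering maps.** Let `G` act freely and properly
discontinuously on a locally compact Hausdorff space `X` with quotient map `f : X → V` (fibres =
`G`-orbits), and let `N ⊴ G`. Then the induced map `f̄ : X ⧸ N → V` is the quotient covering map of
the free, properly discontinuous action of `G ⧸ N` on `X ⧸ N`. [folklore] -/
theorem isQuotientCoveringMap_lift [ContinuousConstSMul G X] [ProperlyDiscontinuousSMul G X]
    [LocallyCompactSpace X] [T2Space X] [IsCancelSMul G X] {f : X → V} (hf : IsQuotientMap f)
    (hfG : ∀ {x y : X}, f x = f y ↔ x ∈ orbit G y) {fbar : orbitRel.Quotient N X → V}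
    (hfbar : ∀ x, fbar (Quotient.mk _ x) = f x) : IsQuotientCoveringMap fbar (G ⧸ N) := by
  haveI := properlyDiscontinuousSMul N (G := G) (X := X)
  haveI := locallyCompactSpace N (G := G) (X := X)
  haveI := isCancelSMul N (G := G) (X := X)
  have hcomp : fbar ∘ Quotient.mk (orbitRel N X) = f := funext hfbar
  have hq : IsQuotientMap fbar :=
    isQuotientMap_quotient_mk'.of_comp_isQuotientMap (hcomp ▸ hf)
  refine hq.isQuotientCoveringMap_of_properlyDiscontinuousSMul ?_
  intro e₁ e₂
  induction e₁ using Quotient.inductionOn with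
  | h x =>
  induction e₂ using Quotient.inductionOn with
  | h y =>
    rw [hfbar, hfbar, mk_mem_orbit_mk_iff]
    exact hfG

/-- **Intermediate quotients of quotient covering maps are covering maps.** [folklore] -/
theorem isCoveringMap_lift [ContinuousConstSMul G X] [ProperlyDiscontinuousSMul G X]
    [LocallyCompactSpace X] [T2Space X] [IsCancelSMul G X] {f : X → V} (hf : IsQuotientMap f)
    (hfG : ∀ {x y : X}, f x = f y ↔ x ∈ orbit G y) {fbar : orbitRel.Quotient N X → V}
    (hfbar : ∀ x, fbar (Quotient.mk _ x) = f x) : IsCoveringMap fbar :=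
  (isQuotientCoveringMap_lift N hf hfG hfbar).isCoveringMap _ _

end OrbitQuotient

end Literature.Topology.CoveringSpaces
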